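import Literature.Computability.QuantumComplexity.PolyCopiesIdx
import HarnessLib

/-!
# Polynomially many parallel indexed copies of a uniform quantum circuit family, II: uniformity

Topic `Literature/Computability/QuantumComplexity`; sequel of `PolyCopiesIdx.lean` (the family whose
block `j < K(n)` runs the given uniform family `F` on the basis input `x ++ e_j`), adapting Part IV of
`PolyCopies.lean` line by line: by `QCircuitFamily.isUniform_of_descFn_mem_FP` it suffices that the
description `1ⁿ ↦ ⟨bin n, ⟨1^{anc n}, encode (circ n)⟩⟩` is in `FP`. `encode (circ n)` is the
concatenation of the description bits of stage 1 — now a *sequence* of two generator programs, the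
two nested loops of the fan-out (`genFan`) and ONE loop emitting the index `NOT`s (`genIdx`:
`for j < K n: NOT (blk j (n + j))`) — and, for every `j < K n`, of "swap, the description of
`F.circ (nIn n)` verbatim (the body of `F.descFn ∈ FP` at the padded unary length `1^{n + K(n)}`,
`padNF`), swap", folded over `j` by the counted concatenation fold with a ruler bounding the pieces
(Arora–Barak 2009, §6.2 and Remark 6.7: descriptions printed with counters). Main result:
`PolyCopiesIdx.family_isUniform`.

## References

* C. H. Bennett, E. Bernstein, G. Brassard, U. Vazirani, *Strengths and weaknesses of quantum
  computing*, SIAM J. Comput. 26 (1997) 1510–1523, Thm. 4.13–4.14 (proofs) [BennettBernsteinBrassardVazirani1997].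
* S. Arora, B. Barak, *Computational Complexity: A Modern Approach*, CUP 2009, §1.3 (bounded loops),
  §6.1–6.2, Def. 6.12, Remark 6.7 [AroraBarak2009].
-/

noncomputable section

namespace Literature.Computability.QuantumComplexity

namespace PolyCopiesIdx

open _root_.Computability Complexity Cryptography RevSim RevMux Function Matrix Finset

variable (P : PolyCopies.Params)

section Uniform

open Polynomial Complexity.Brick Plumb RevDesc RevClean Complexity.GExpr

/-! ### Stage descriptions are program descriptions -/

section Desc

variable {P}

/-- The description bits of a clamped compiled program are the `opBits` of the program.
[cite: AroraBarak2009, §6.1 (descriptions of circuits)] -/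
theorem flatMap_gateEnc_clamp (n : ℕ) (ops : List (ClOp ℕ)) (hlt : ∀ op ∈ ops, ∀ i ∈ wiresOf op, i < n + anc P n)
    (hwf : ∀ op ∈ ops, op.WF) :
    (revCompile (clamp P n ops hlt hwf)).flatMap gateEnc = ops.flatMap opBits :=
  flatMap_gateEnc_revCompile_toRevList (width_pos n) ops hlt _

/-- Stage 1 describes as `prog1`. [folklore] -/
theorem flatMap_gateEnc_stage1 (n : ℕ) : (stage1 P n).flatMap gateEnc = (prog1 P n).flatMap opBits :=
  flatMap_gateEnc_clamp n _ _ _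

/-- The conjugating swap describes as `progConj` (for `j < K n`). [folklore] -/
theorem flatMap_gateEnc_conjGates {n j : ℕ} (hj : j < K P n) :
    (conjGates P n j).flatMap gateEnc = (progConj P n j).flatMap opBits := by
  unfold conjGates; rw [dif_pos hj]; exact flatMap_gateEnc_clamp n _ _ _

/-- The copy describes as the given circuit, verbatim. [cite: AroraBarak2009, §6.2 (a circuit for each input length, hard-wired)] -/
theorem flatMap_gateEnc_copyGates (n : ℕ) : (copyGates P n).flatMap gateEnc = (P.F.circ (nIn P n)).encode := by
  unfold copyGates
  rw [show (P.F.circ (nIn P n)).encode = QCircuit.encode (⟨(P.F.circ (nIn P n)).gates⟩ : QCircuit cliffordT _) from rfl,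
    encode_eq_flatMap]
  simp only [mapWires, List.flatMap_map, CWrap.gateEnc_mapWiresGate_castLEEmb]

end Desc

/-! ### The layout as counter expressions and as polynomials -/

/-- The number of copies `K` as an expression in the input length `uu`. [folklore] -/
def KE : GE := .add (CWrap.polyE P.pK (.var .uu)) (.const 1)

/-- The copy input length `nIn = uu + K` as an expression. [folklore] -/
def nInE : GE := .add (.var .uu) (KE P)

/-- The block width `b` as an expression. [folklore] -/
def bE : GE := .add (.add (nInE P) (CWrap.polyE P.pF (nInE P))) (.const 2)

/-- The first block wire `base` as an expression. [folklore] -/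
def baseE : GE := .add (bE P) (.const 1)

/-- Wire `i` of block `j` as an expression transformer. [folklore] -/
def blkE (jE iE : GE) : GE := .add (.add (baseE P) (.mul jE (bE P))) iE

/-- `K(n)` as a polynomial. [folklore] -/
def KPoly : Polynomial ℕ := P.pK + 1

/-- `nIn(n)` as a polynomial. [folklore] -/
def nInPoly : Polynomial ℕ := X + KPoly P

/-- `b(n)` as a polynomial. [folklore] -/
def bPoly : Polynomial ℕ := nInPoly P + P.pF.comp (nInPoly P) + C 2

/-- `base(n)` as a polynomial. [folklore] -/
def basePoly : Polynomial ℕ := bPoly P + 1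

/-- `W(n)` as a polynomial. [folklore] -/
def WPoly : Polynomial ℕ := basePoly P + KPoly P * bPoly P

variable {P}

/-- Value of `KE`. [folklore] -/
@[simp] theorem eval_KE (env : GV → ℕ) : (KE P).eval env = K P (env .uu) := by simp [KE, GExpr.eval, K]

/-- Value of `nInE`. [folklore] -/
@[simp] theorem eval_nInE (env : GV → ℕ) : (nInE P).eval env = nIn P (env .uu) := by simp [nInE, GExpr.eval, nIn]

/-- Value of `bE`. [folklore] -/
@[simp] theorem eval_bE (env : GV → ℕ) : (bE P).eval env = b P (env .uu) := by simp [bE, GExpr.eval, b]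

/-- Value of `baseE`. [folklore] -/
@[simp] theorem eval_baseE (env : GV → ℕ) : (baseE P).eval env = base P (env .uu) := by simp [baseE, GExpr.eval, base]

/-- Value of `blkE`. [folklore] -/
@[simp] theorem eval_blkE (jE iE : GE) (env : GV → ℕ) : (blkE P jE iE).eval env = blk P (env .uu) (jE.eval env) (iE.eval env) := by
  simp [blkE, GExpr.eval, blk]

/-- Value of `KPoly`. [folklore] -/
@[simp] theorem eval_KPoly (n : ℕ) : (KPoly P).eval n = K P n := by simp [KPoly, K]

/-- Value of `nInPoly`. [folklore] -/
@[simp] theorem eval_nInPoly (n : ℕ) : (nInPoly P).eval n = nIn P n := by simp [nInPoly, nIn]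

/-- Value of `bPoly`. [folklore] -/
@[simp] theorem eval_bPoly (n : ℕ) : (bPoly P).eval n = b P n := by simp [bPoly, b, Polynomial.eval_comp]

/-- Value of `basePoly`. [folklore] -/
@[simp] theorem eval_basePoly (n : ℕ) : (basePoly P).eval n = base P n := by simp [basePoly, base]

/-- Value of `WPoly`. [folklore] -/
@[simp] theorem eval_WPoly (n : ℕ) : (WPoly P).eval n = W P n := by simp [WPoly, W]

/-! ### Stage 1: a generator with two nested loops, then one loop -/

variable (P)

/-- **Generator of the fan-out**: `for j < K n, for i < n: CNOT i (blk j i)`. [cite: AroraBarak2009, §6.2 (descriptions printed with counters)] -/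
def genFan : GS :=
  GStmt.loop .jj (KE P) (GStmt.loop .tt (.var .uu) (opsG [ClOp.cnot (.var .tt) (blkE P (.var .jj) (.var .tt))]))

/-- **Generator of the indices**: `for j < K n: NOT (blk j (n + j))`. [cite: AroraBarak2009, §6.2 (descriptions printed with counters)] -/
def genIdx : GS :=
  GStmt.loop .jj (KE P) (opsG [ClOp.not (blkE P (.var .jj) (.add (.var .uu) (.var .jj)))])

/-- **Generator of stage 1**: fan-out, then indices. [cite: AroraBarak2009, §6.2 (descriptions printed with counters)] -/
def gen1 : GS := GStmt.seq (genFan P) (genIdx P)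

variable {P}

/-- The fan-out generator prints `progFan`. [folklore] -/
theorem out_genFan (env : GV → ℕ) : (genFan P).out env = (progFan P (env .uu)).flatMap opToks := by
  have hut : ∀ k k', Function.update (Function.update env GV.jj k) GV.tt k' GV.uu = env GV.uu := fun k k' => by
    rw [Function.update_of_ne (by decide), Function.update_of_ne (by decide)]
  have hutj : ∀ k k', Function.update (Function.update env GV.jj k) GV.tt k' GV.jj = k := fun k k' => by
    rw [Function.update_of_ne (by decide), Function.update_self]
  have huj : ∀ k, Function.update env GV.jj k GV.uu = env GV.uu := fun k => Function.update_of_ne (by decide) _ _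
  simp only [genFan, GStmt.out, out_opsG, List.map_cons, List.map_nil, ClOp.map, GExpr.eval, Function.update_self, hut, hutj,
    huj, eval_blkE, eval_KE, List.flatMap_cons, List.flatMap_nil, List.append_nil, progFan, List.flatMap_assoc, List.flatMap_map]

/-- The index generator prints `progIdx`. [folklore] -/
theorem out_genIdx (env : GV → ℕ) : (genIdx P).out env = (progIdx P (env .uu)).flatMap opToks := by
  have huj : ∀ k, Function.update env GV.jj k GV.uu = env GV.uu := fun k => Function.update_of_ne (by decide) _ _
  simp only [genIdx, GStmt.out, out_opsG, List.map_cons, List.map_nil, ClOp.map, GExpr.eval, Function.update_self,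
    huj, eval_blkE, eval_KE, List.flatMap_cons, List.flatMap_nil, List.append_nil, progIdx, idxWires, List.map_map,
    List.flatMap_map, Function.comp_def]

/-- **The stage-1 generator prints `prog1`.** [folklore] -/
theorem out_gen1 (env : GV → ℕ) : (gen1 P).out env = (prog1 P (env .uu)).flatMap opToks := by
  simp only [gen1, GStmt.out, out_genFan, out_genIdx, prog1, List.flatMap_append]

/-- `uu` is not a loop variable of the stage-1 generator. [folklore] -/
theorem uu_notMem_loopVars_gen1 : GV.uu ∉ (gen1 P).loopVars := by
  intro h
  simp only [gen1, genFan, genIdx, GStmt.loopVars, List.mem_append, List.mem_cons] at h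
  rcases h with ((h | h | h) | (h | h))
  · exact absurd h (by decide)
  · exact absurd h (by decide)
  · exact absurd (loopVars_opsG_sub _ _ h) (by decide)
  · exact absurd h (by decide)
  · exact absurd (loopVars_opsG_sub _ _ h) (by decide)

/-- Non-reuse of the stage-1 generator. [folklore] -/
theorem noReuse_gen1 : (gen1 P).noReuse = true :=
  noReuse_seq_of
    (noReuse_loop_of (lv_loop (P := (· ≠ GV.jj)) (by decide) (lv_opsG (by decide) _))
      (noReuse_loop_of (lv_opsG (by decide) _) (noReuse_opsG _)))
    (noReuse_loop_of (lv_opsG (by decide) _) (noReuse_opsG _))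

/-- **Stage 1 describes in polynomial time.** [cite: AroraBarak2009, §6.2 Def. 6.12 and Remark 6.7 (descriptions printed in polynomial time)] -/
theorem stage1_desc_mem_FP : (fun z : List Bool => (stage1 P z.length).flatMap gateEnc) ∈ FP := by
  have h := GStmt.render_out_mem_FP (gen1 P) GV.uu uu_notMem_loopVars_gen1 noReuse_gen1
  refine (congrArg (· ∈ FP) (funext fun z => ?_)).mpr h
  rw [out_gen1, RevClean.render_flatMap_opToks_nil, GenProg.initEnv_self, flatMap_gateEnc_stage1]

/-! ### The quantum stage: a counted fold of swap–copy–swap pieces -/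

section StageQ

variable (P)

/-- The context field of the piece: `z = 1ⁿ` (as `⟨⟨z, ruler⟩, 1ʲ⟩ ↦ z`). [folklore] -/
def zOf : List Bool → List Bool := fstF ∘ fstF

/-- The swap piece: the description of the swap of the front window with block `j`, from
`⟨⟨1ⁿ, ruler⟩, 1ʲ⟩` (offset `base n + j · b n` in binary, `1^{b n}`). [folklore] -/
def swF : List Bool → List Bool :=
  SwapDesc.swapDescFn ∘ fanoutFn
    (addFn ∘ fanoutFn (lenBinF ∘ polyFn (basePoly P) ∘ zOf)
      (prodFn ∘ fanoutFn (lenBinF ∘ sndF) (lenBinF ∘ polyFn (bPoly P) ∘ zOf)))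
    (polyFn (bPoly P) ∘ zOf)

/-- Padding `1ⁿ` to `1^{nIn n}` (the input length of the copies). [folklore] -/
def padNF : List Bool → List Bool := appF ∘ fanoutFn (fun z => z) (polyFn (KPoly P))

/-- The copy piece: the body of the given family's description at `1^{nIn n}`. [folklore] -/
def copyF : List Bool → List Bool := sndF ∘ sndF ∘ P.F.descFn ∘ padNF P ∘ zOf

/-- The piece of index `j`: swap, copy, swap. [folklore] -/
def pieceQ : List Bool → List Bool := appF ∘ fanoutFn (swF P) (appF ∘ fanoutFn (copyF P) (swF P))

variable {P}

/-- `swF` computes the description of the conjugating swap. [folklore] -/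
theorem swF_apply (z r : List Bool) (j : ℕ) :
    swF P (boolPair (boolPair z r) (ones j)) = (progConj P z.length j).flatMap opBits := by
  have h : swF P (boolPair (boolPair z r) (ones j)) =
      SwapDesc.swapDescFn (boolPair (encodeNat (base P z.length + j * b P z.length)) (ones (b P z.length))) := by
    simp [swF, zOf, fanoutFn_apply, ones]
  rw [h, SwapDesc.swapDescFn_apply]
  rfl

/-- `padNF` pads `z` to length `nIn |z|`. [folklore] -/
theorem padNF_apply (z : List Bool) : padNF P z = z ++ ones (K P z.length) := by
  simp [padNF, fanoutFn_apply]

/-- The length of the padded string. [folklore] -/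
@[simp] theorem length_padNF (z : List Bool) : (padNF P z).length = nIn P z.length := by
  simp [padNF_apply, ones, nIn]

/-- `copyF` computes the description of the copy. [folklore] -/
theorem copyF_apply (z r : List Bool) (j : ℕ) :
    copyF P (boolPair (boolPair z r) (ones j)) = (copyGates P z.length).flatMap gateEnc := by
  rw [flatMap_gateEnc_copyGates, copyF]
  simp only [Function.comp_apply, zOf, fstF_boolPair, CWrap.sndF_sndF_descFn]
  rw [length_padNF]

/-- The piece of index `j < K n` is the description of swap–copy–swap. [folklore] -/
theorem pieceQ_apply (z r : List Bool) {j : ℕ} (hj : j < K P z.length) :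
    pieceQ P (boolPair (boolPair z r) (ones j)) =
      (conjGates P z.length j ++ (copyGates P z.length ++ conjGates P z.length j)).flatMap gateEnc := by
  rw [List.flatMap_append, List.flatMap_append, flatMap_gateEnc_conjGates hj, ← copyF_apply z r j, ← swF_apply z r j]
  simp [pieceQ, fanoutFn_apply]

/-- `swF ∈ FP`. [folklore] -/
theorem swF_mem_FP : swF P ∈ FP := by
  have hz : zOf ∈ FP := comp_mem_FP fstF_mem_FP fstF_mem_FP
  exact comp_mem_FP SwapDesc.swapDescFn_mem_FP (fanoutFn_mem_FP
    (comp_mem_FP addFn_mem_FP (fanoutFn_mem_FP (comp_mem_FP lenBinF_mem_FP (comp_mem_FP (polyFn_mem_FP _) hz))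
      (comp_mem_FP prodFn_mem_FP (fanoutFn_mem_FP (comp_mem_FP lenBinF_mem_FP sndF_mem_FP)
        (comp_mem_FP lenBinF_mem_FP (comp_mem_FP (polyFn_mem_FP _) hz))))))
    (comp_mem_FP (polyFn_mem_FP _) hz))

/-- `padNF ∈ FP`. [folklore] -/
theorem padNF_mem_FP : padNF P ∈ FP :=
  comp_mem_FP appF_mem_FP (fanoutFn_mem_FP (PolyTimeComputable.id _) (polyFn_mem_FP _))

/-- `copyF ∈ FP` for a uniform family. [folklore] -/
theorem copyF_mem_FP (hU : P.F.IsUniform) : copyF P ∈ FP :=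
  comp_mem_FP sndF_mem_FP (comp_mem_FP sndF_mem_FP (comp_mem_FP (QCircuitFamily.descFn_mem_FP_of_isUniform hU)
    (comp_mem_FP padNF_mem_FP (comp_mem_FP fstF_mem_FP fstF_mem_FP))))

/-- `pieceQ ∈ FP` for a uniform family. [folklore] -/
theorem pieceQ_mem_FP (hU : P.F.IsUniform) : pieceQ P ∈ FP :=
  comp_mem_FP appF_mem_FP (fanoutFn_mem_FP swF_mem_FP (comp_mem_FP appF_mem_FP (fanoutFn_mem_FP (copyF_mem_FP hU) swF_mem_FP)))

variable (P) (ps pd : Polynomial ℕ)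

/-- The ruler polynomial: room for the rounds and for every piece. [folklore] -/
def rulerPoly : Polynomial ℕ :=
  KPoly P + (C 2 * ps.comp (C 2 * WPoly P + C 2 + bPoly P) + pd.comp (nInPoly P))

/-- The initial record of the fold: `⟨⟨z, ruler⟩, ⟨bin (K n), ⟨1⁰, []⟩⟩⟩`. [folklore] -/
def initQ : List Bool → List Bool :=
  fanoutFn (fanoutFn (fun z => z) (polyFn (rulerPoly P ps pd))) (fanoutFn (lenBinF ∘ polyFn (KPoly P)) (fun _ => boolPair [] []))

/-- **The description of the quantum stage** as a string function: fold the pieces `j < K n`.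
[cite: AroraBarak2009, §1.3 (bounded loops)] -/
def sqF : List Bool → List Bool := sndPow 2 ∘ foldLoop appF (clipF 1 (pieceQ P)) X ∘ initQ P ps pd

variable {P}

/-- `sqF ∈ FP`. [folklore] -/
theorem sqF_mem_FP (hU : P.F.IsUniform) : sqF P ps pd ∈ FP :=
  comp_mem_FP (sndPow_mem_FP 2) (comp_mem_FP (foldLoop_clipF_mem_FP 1 appF_mem_FP length_appF_le (pieceQ_mem_FP hU) X)
    (fanoutFn_mem_FP (fanoutFn_mem_FP (PolyTimeComputable.id _) (polyFn_mem_FP _))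
      (fanoutFn_mem_FP (comp_mem_FP lenBinF_mem_FP (polyFn_mem_FP _)) (const_mem_FP _))))

/-- **The fold computes the description of the quantum stage**, provided the ruler bounds the
pieces: `|swapDescFn v| ≤ ps |v|` and `|descFn u| ≤ pd |u|`. [folklore] -/
theorem sqF_apply (hps : ∀ v, (SwapDesc.swapDescFn v).length ≤ ps.eval v.length)
    (hpd : ∀ u, (P.F.descFn u).length ≤ pd.eval u.length) (z : List Bool) :
    sqF P ps pd z = (stageQ P z.length).flatMap gateEnc := by
  set n := z.length with hn
  set ctx := boolPair z (ones ((rulerPoly P ps pd).eval n)) with hctx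
  have hinit : initQ P ps pd z = boolPair ctx (boolPair (encodeNat (K P n)) (boolPair (ones 0) [])) := by
    simp [initQ, fanoutFn_apply, hctx, hn, ones]
  have hrounds : K P n ≤ (X : Polynomial ℕ).eval ctx.length := by
    rw [eval_X, hctx, length_boolPair]
    have : K P n ≤ (rulerPoly P ps pd).eval n := by simp [rulerPoly]
    simp [ones]; omega
  -- the pieces are within the ruler
  have hpiece : ∀ j, 0 ≤ j → j < 0 + K P n → (pieceQ P (boolPair ctx (ones j))).length ≤ 1 * (ctx.length + 1) := by
    intro j _ hj
    have hjK : j < K P n := by omega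
    rw [hctx, pieceQ_apply z _ (by rw [← hn]; exact hjK), List.flatMap_append, List.flatMap_append, List.length_append,
      List.length_append, flatMap_gateEnc_conjGates (by rw [← hn]; exact hjK), flatMap_gateEnc_copyGates, ← hn]
    -- the swap part
    have hsw : ((progConj P n j).flatMap opBits).length ≤ ps.eval (2 * W P n + 2 + b P n) := by
      rw [← swF_apply z (ones ((rulerPoly P ps pd).eval n)) j]
      have h := hps (boolPair (encodeNat (base P n + j * b P n)) (ones (b P n)))
      have e : swF P (boolPair (boolPair z (ones ((rulerPoly P ps pd).eval n))) (ones j)) =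
          SwapDesc.swapDescFn (boolPair (encodeNat (base P n + j * b P n)) (ones (b P n))) := by
        simp [swF, zOf, fanoutFn_apply, ones, hn]
      rw [e]
      refine h.trans (TM2Iter.eval_mono ps ?_)
      rw [length_boolPair]
      have hb : (encodeNat (base P n + j * b P n)).length ≤ W P n := by
        refine (Complexity.length_encodeNat_le_self _).trans ?_
        have h4 : j * b P n ≤ K P n * b P n := Nat.mul_le_mul_right _ hjK.le
        unfold W; omega
      simp [ones]; omega
    -- the copy part
    have hcp : (P.F.circ (nIn P n)).encode.length ≤ pd.eval (nIn P n) := by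
      have h := hpd (padNF P z)
      rw [QCircuitFamily.descFn_eq, length_boolPair, length_boolPair, length_padNF, ← hn] at h
      omega
    rw [length_boolPair]
    have hr : (rulerPoly P ps pd).eval n = K P n + (2 * ps.eval (2 * W P n + 2 + b P n) + pd.eval (nIn P n)) := by
      simp [rulerPoly, Polynomial.eval_comp]
    simp only [ones, List.length_replicate, one_mul]
    omega
  rw [sqF, Function.comp_apply, Function.comp_apply, hinit, foldLoop_apply appF (clipF 1 (pieceQ P)) hrounds 0 [],
    sndPow_succ_boolPair, sndPow_succ_boolPair, sndPow_zero_boolPair, foldAcc_clipF hpiece, foldAcc_appF, List.nil_append,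
    stageQ, List.flatMap_assoc, CWrap.flatMap_range_eq_ccat]
  refine ccat_congr fun j hj => ?_
  rw [Nat.zero_add, hctx, pieceQ_apply z _ (by rw [← hn]; omega), ← hn]

end StageQ

/-! ### The header and the assembly -/

variable (P)

/-- The ancilla count in unary: `1^{W n}` with the first `n` symbols dropped. [folklore] -/
def ancF : List Bool → List Bool := dropFn ∘ fanoutFn (fun z => z) (polyFn (WPoly P))

variable {P}

/-- Value of `ancF`. [folklore] -/
theorem ancF_apply (z : List Bool) : ancF P z = unaryEncodeNat (anc P z.length) := by
  simp only [ancF, Function.comp_apply, fanoutFn_apply, dropFn_boolPair, polyFn_apply, eval_WPoly, ones, List.drop_replicate, anc]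
  exact (RevDesc.unaryEncodeNat_eq_replicate _).symm

/-- `ancF ∈ FP`. [folklore] -/
theorem ancF_mem_FP : ancF P ∈ FP := comp_mem_FP dropFn_mem_FP (fanoutFn_mem_FP (PolyTimeComputable.id _) (polyFn_mem_FP _))

variable (P)

/-- **The `K(n)`-copy family is polynomial-time uniform** (if the given family is). [cite: AroraBarak2009, §6.2 Def. 6.12 and Remark 6.7 (descriptions printed in polynomial time)] -/
theorem family_isUniform (hU : P.F.IsUniform) : (family P).IsUniform := by
  obtain ⟨ps, hps⟩ := exists_poly_length_le_of_mem_FP SwapDesc.swapDescFn_mem_FP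
  obtain ⟨pd, hpd⟩ := exists_poly_length_le_of_mem_FP (QCircuitFamily.descFn_mem_FP_of_isUniform hU)
  refine QCircuitFamily.isUniform_of_descFn_mem_FP ?_
  have h := fanoutFn_mem_FP lenBinF_mem_FP (fanoutFn_mem_FP (ancF_mem_FP (P := P))
    (append_mem_FP (stage1_desc_mem_FP (P := P)) (sqF_mem_FP ps pd hU)))
  have e : (family P).descFn = fanoutFn lenBinF (fanoutFn (ancF P)
      (fun z => (stage1 P z.length).flatMap gateEnc ++ sqF P ps pd z)) := by
    funext z
    have henc : (circ P z.length).encode = (stage1 P z.length ++ stageQ P z.length).flatMap gateEnc := by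
      unfold circ; exact encode_eq_flatMap _
    rw [fanoutFn_apply, fanoutFn_apply, lenBinF_apply, ancF_apply, sqF_apply ps pd hps hpd, QCircuitFamily.descFn_eq]
    dsimp only [family_circ, family_ancillas]
    rw [henc, List.flatMap_append]
  rw [e]
  exact h

end Uniform

end PolyCopiesIdx

end Literature.Computability.QuantumComplexity

end
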